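import Mathlib
import HarnessLib
import Summits.CriticalPhenomena.CardyFormulaZ2.Statement
import Summits.CriticalPhenomena.CardyFormulaZ2.Theses.CardyMagicRigidity

/-!
# Route CardyMagicRigidity — the `Assembly` item (stmt-CriticalPhenomena-11207)

The assembly of route `route-CriticalPhenomena-CardyMagicRigidity`:

  `MagicFormulaZ2 → MagicFormulaT → NestingRigidity → LoopsToCrossings → SmirnovTri → CardyFormulaZ2`.

This is pure logic over the listed items (no mathematical content of its own):
* `NestingRigidity` is, by definition, `(body of MagicFormulaZ2) → (body of MagicFormulaT) → X` with
  `X = LoopLimitZ2EqT` (full-plane loop universality ℤ² ~ 𝕋 in DKKMO's coupling distance), so the two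
  magic formulas and rigidity give `X`;
* `LoopsToCrossings` turns `X` into crossing universality
  `bondDomainCrossingProb R δ − triDomainCrossingProb R δ → 0` for every conformal rectangle `R`;
* `SmirnovTri` (Smirnov's theorem on 𝕋, the Literature fact
  `hasCrossingLimit_triDomainCrossingProb`, proved in the tree) gives
  `triDomainCrossingProb R δ → F(η)`; adding the two limits (`Filter.Tendsto.add`) gives
  `bondDomainCrossingProb R δ → F(η)`, i.e. `CardyFormulaZ2`.

The proof is the body of the route's deciding theorem `closes` restricted to the listed hypotheses.
-/

namespace Summit.CriticalPhenomena.CardyFormulaZ2.Theorems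

open Summit.CriticalPhenomena.CardyFormulaZ2.Theses.CardyMagicRigidity

/-- **Assembly of route CardyMagicRigidity** (item stmt-CriticalPhenomena-11207):
`MagicFormulaZ2 → MagicFormulaT → NestingRigidity → LoopsToCrossings → SmirnovTri → CardyFormulaZ2`.
Pure glue: rigidity applied to the two magic formulas gives full-plane loop universality
`X = LoopLimitZ2EqT`; `LoopsToCrossings` gives `bond − tri → 0` in every conformal rectangle;
Smirnov's theorem on 𝕋 (`SmirnovTri`) gives `tri → F(η)`; the sum of the two limits is Cardy's
formula on ℤ². -/
theorem cardyMagicRigidity_assembly_proof : Summit.CriticalPhenomena.CardyFormulaZ2.Theses.CardyMagicRigidity.Assembly := by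
  unfold Summit.CriticalPhenomena.CardyFormulaZ2.Theses.CardyMagicRigidity.Assembly
  intro h2 h4 h3 h5 hS
  -- X = LoopLimitZ2EqT from the two magic formulas and nesting rigidity
  -- (`NestingRigidity` unfolds to `(body of MagicFormulaZ2) → (body of MagicFormulaT) → (body of X)`):
  have hX : LoopLimitZ2EqT := h3 h2 h4
  -- X ⇒ crossing universality ℤ² ~ 𝕋 in every conformal rectangle:
  have hdiff := h5 hX
  -- Cardy's formula on ℤ²: for every conformal rectangle and uniformizing datum, bond → F(η).
  intro R φ x hux
  have htri : Filter.Tendsto (Literature.Probability.Percolation.triDomainCrossingProb R)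
      (nhdsWithin 0 (Set.Ioi 0))
      (nhds (Literature.Probability.RandomPlanarGeometry.cardyFunction
        (Literature.Probability.RandomPlanarGeometry.crossRatio x))) := hS R φ x hux
  have key := (hdiff R).add htri
  simp only [sub_add_cancel, zero_add] at key
  exact key

end Summit.CriticalPhenomena.CardyFormulaZ2.Theorems
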